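import Literature.AnabelianGeometry.EtaleTheta.Discharge.Sec5Thm56EndKnitLevelN
import Literature.AnabelianGeometry.EtaleTheta.ThetaSubquotientOfTemperedAut

/-!
# [EtTh] Prop. 5.5 ⊕ Thm. 5.6 (i) — K4 END KNIT AT LEVEL `N`, CARRIER-LEVEL Δ-LAWS: `haΨn` and the T56-L09c compatibility `hΔ`
# DERIVED from laws on abc-iut-L2-t9's `(l·Δ_Θ)_(−)` (the currency of the `psiTransport` producers), `P` pinned by BOTH pins

Mochizuki, *The étale theta function and its Frobenioid-theoretic manifestations*, Publ. RIMS **45** (2009)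
[cite: MochizukiEtTh2009, Prop 5.5 p.327 (PDF p.101); Thm 5.6 p.328–329 (PDF pp.102–103); §5 p.330–331 (PDF pp.104–105)].
abc-iut cell, layer L2, row K4 «SUBDAG-Thm56» — T56-L03 step 2 via option (c) (seat abc-iut-w5-d034, gen 5; sub-DAG
plan/L2/SUBDAG-EtTh-Thm56.md, node EtTh:Prop5.5 + EtTh:Thm5.6(i); abc-iut-w5-d013's ONE-DECISION request 2026-08-26T11:47Z).
PROOF-ONLY (no definitions; nothing of the producers restated).

`ThetaFrobenioid.exists_rigidityFamily_unique_preserved_ofConnectedTemperoidData_levelN_carrier` — the level-`N` end knit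
`…_ofConnectedTemperoidData_levelN` (`Sec5Thm56EndKnitLevelN`, p442234: [EtTh] Prop. 5.5 ⊕ Thm. 5.6 (i) at abc-iut-L2-t4's genuine §5 data
`ofConnectedTemperoidData` over `B^temp(Π^tp_X)⁰` with `Q := RD.levelStub ιX` and `P` pinned at `B_N^bs` by abc-iut-w4-d042's `hPpre`) with its
two Thm-5.6-specific Δ-side LAWS re-sourced from the CARRIER level — abc-iut-L2-t9's theta subquotients `(l·Δ_Θ)_E = LDelta q_N ι_N E` BEFORE
`⊗ ℤ/Nℤ`, the level at which abc-iut-w5-d013's transport `ThetaSubquotient.psiTransport` (p442611; `map_psiTransport`, `psiTransport_autProj`)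
and abc-iut-w4-d042's `map_autProj_eq_autProj_conj` / abc-iut-w5-d013's `map_autProj_iso` live:

* the Δ-transport `aΨ A : (l·Δ_Θ)_A ⊗ ℤ/Nℤ ⥲ (l·Δ_Θ)_{Ψ A} ⊗ ℤ/Nℤ` keeps its 𝔉-level type and comes WITH a carrier-level lift
  `δ A : (l·Δ_Θ)_{A^bs} ⥲ (l·Δ_Θ)_{(Ψ A)^bs}` and the identification `haΨδ : aΨ A [y] = [δ A y]` (for `aΨ A := modPowEquiv (δ A) N` this is
  abc-iut-w5-d013's `modPowEquiv_mk`, `rfl`);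
* `haΨn` (naturality of `aΨ` along the morphisms of `C`) is DERIVED from the carrier-level naturality `hδn` of `δ` (the shape of
  `map_psiTransport` for the `eΨ`-squares) — `⊗ ℤ/Nℤ` on classes is `QuotientGroup.map_mk` and the data's transport IS abc-iut-L2-t9's `map`
  (`rfl`);
* `hΔ` = abc-iut-w5-d020's typed T56-L09c predicate `Thm56Sub.DeltaTransportCompat 𝔉 Ψ β aΨ θ′ P` for the `B_N`-transport
  `θ′ := (s'_N)^bs-conjugate` of every admissible base shadow `θA` is DERIVED from the carrier-level law `hδc`
  («`map (β^bs) ∘ δ_{B_N} ∘ autProj = autProj ∘ θ′` on print's `Aut`-subquotient domain `autPre q_N ι_N (B_N^bs)`», the shape of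
  `psiTransport_autProj` + `map_autProj_iso` + the identification of the conjugating isomorphism) through the TWO pins of `P` at `B_N^bs`:
  `hPpre` (`P.pre = comap (Aut_D(B_N^bs) ↪ Aut(B_N^bs.obj)) (autPre q_N ι_N)`, abc-iut-w4-d042) and the proj-pin `hPproj_pin`
  (`P.proj = autProj q_N ι_N ∘ (Aut_D(B_N^bs) ↪ Aut(B_N^bs.obj))` — abc-iut-w4-d042's convention; its producers `e`/`he`/`hPproj`/`hproj` are
  abc-iut-w4-d042's row and stay binders here).

ELABORATION NOTE (recorded for the lineage; it is the «heartbeat wall» of abc-iut-w4-d042's `Sec5Prop55OfConnectedTemperoidLevelN` note and of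
abc-iut-w5-d013's T56-L03-STEP2 memo): every conversion 𝔉-level ↔ carrier-level used here is `rfl` within the DEFAULT budget; what sends
`isDefEq`/`whnf` through the four-deep §5 definitional stack is (i) applying a lemma whose universe signature contains `max u₀ w'` WITHOUT
explicit universe arguments (the level problem `max ?u₀ ?w' =?= max u₀ w'` is not solved structurally and the unifier falls back to
δ-unfolding `mkOfConnectedTemperoid` / `ofConnectedTemperoidData` — cure: `lemma.{u₀, v₀, w', v₁, u₁} …`, as in the last `exact` below),
(ii) `S`-terms that differ by δ (`mkOfConnectedTemperoidYdd` vs `mkOfConnectedTemperoid A₀`), (iii) `rw` motives through 𝔉-projections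
(use `Eq.trans` chains, as below).

RESIDUAL binders = those of p442234 MINUS {`haΨn`, `hΔ`} PLUS {`δ`, `haΨδ`, `hδn`, `hδc`, `hPproj_pin`} — a RE-SOURCING, not yet a reduction:
`(δ, haΨδ, hδn)` are produced by `psiTransport` / `modPowEquiv_mk` / `map_psiTransport` from the [SemiAnbd] Prop. 3.2 datum `(φ, η)` of `Ψ^bs`
and its level-`N` descent `(φQ, φΛ, hq, hι)` (abc-iut-w5-d013, p435495 / p438441), and `hδc` is the remaining bookkeeping (sequel file).
HONEST NOTE on `P` (DUAL CLAUSE, GAP-LEDGER G-w4d042g3-1): no `P`-term until v-next `proj_surjective_of_isGaloisObj`; both pins hold for the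
v-next term by construction.  HONEST FRAMING: kernel-checked implications between typed statements; nothing asserts that such data exist for
an actual curve; typed ≠ discharged; [EtTh] is refereed and nothing here bears on [IUTchIII] Cor. 3.12 — no side taken.
-/

noncomputable section

namespace Literature.AnabelianGeometry.EtaleTheta

open CategoryTheory Opposite FrobenioidCyclotomicRigidity Literature.AlgebraicGeometry.Frobenioids
  Literature.AnabelianGeometry.SemiGraphs Literature.AnabelianGeometry.SemiGraphs.GaloisObjects

universe u₀ v₀ w' v₁ u₁

namespace ThetaFrobenioid

section Connected

variable {K : Type u₀} [Field K] {X : SemiGraphs.TemperedArithmeticGroup.{u₀} K} {D₀ : Type u₀} [Category.{v₀} D₀]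
  {V : FrdIMonoidStub.{max u₀ w'}} {T₀ : RealifiedDivisorMonoids (D₀ := D₀) V}
  {VD : FrdICatStub.{u₀ + 1, u₀, max u₀ w'} (ConnectedPart (BTemp X.Pi))}
  {tf : TemperedFrobenioid T₀ (ConnectedPart (BTemp X.Pi)) VD} {hZ : tf.monoidType = MonoidType.Z}
  {hP : ∀ A : (ConnectedPart (BTemp X.Pi))ᵒᵖ, IsPerfect (tf.Φ.carrier A)}
  {NH : Subgroup (Field.absoluteGaloisGroup K) → tf.category → ℕ+ → Prop} {A₀ : tf.category}
  {hA₀ : PreFrobenioid.IsFrobeniusTrivial tf.toElem A₀} {hA₀' : SemiGraphs.IsGaloisObj A₀.base.obj}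
  {lv N : ℕ+} {l' : ℕ} {RD : RigidData.{max u₀ w'} N l'}
  {pullFrac : ∀ {A A' : (BiKummerSetting.mkOfConnectedTemperoid X tf hZ hP NH A₀ hA₀ hA₀').C} (_ : A' ⟶ A),
    (BiKummerSetting.mkOfConnectedTemperoid X tf hZ hP NH A₀ hA₀ hA₀').biratUnits A →
      (BiKummerSetting.mkOfConnectedTemperoid X tf hZ hP NH A₀ hA₀ hA₀').biratUnits A'}
  {θ : (BiKummerSetting.mkOfConnectedTemperoid X tf hZ hP NH A₀ hA₀ hA₀').biratUnits
    (BiKummerSetting.mkOfConnectedTemperoid X tf hZ hP NH A₀ hA₀ hA₀').Aodot}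
  {Bl : (BiKummerSetting.mkOfConnectedTemperoid X tf hZ hP NH A₀ hA₀ hA₀').C}
  {Pl : (BiKummerSetting.mkOfConnectedTemperoid X tf hZ hP NH A₀ hA₀ hA₀').FractionPair θ Bl}
  {Rl : (BiKummerSetting.mkOfConnectedTemperoid X tf hZ hP NH A₀ hA₀ hA₀').NthRoot θ Pl lv pullFrac}
  (h : ModelFrobenioid.Hypotheses tf.divisorMonoid tf.ratFnFunctor)
  (odd_l : Odd (lv : ℕ))
  (R : (BiKummerSetting.mkOfConnectedTemperoid X tf hZ hP NH A₀ hA₀ hA₀').NthRoot Rl.root Rl.pair N pullFrac)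
  (ιX : RD.PiX ≃ₜ* X.Pi) (K' : Type (max u₀ w')) [Field K'] (constEmb : K'ˣ →* tf.biratUnitsModel R.BN)
  (constEmb_injective : Function.Injective constEmb)
  (hinvc : ∀ g : Aut R.AN.base,
    pull tf.divisorMonoid g.hom (ModelFrobenioid.div R.pair.num) = ModelFrobenioid.div R.pair.num)
  (hinvp : ∀ y : RD.PiX, y ∈ RD.PiYdd →
    pull tf.divisorMonoid ((BiKummerSetting.mkOfConnectedTemperoid X tf hZ hP NH A₀ hA₀ hA₀').galoisSurj R.AN.base
      R.αData.isGalois (ιX y)).hom (ModelFrobenioid.div R.pair.den) = ModelFrobenioid.div R.pair.den)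

/-- **K4 END KNIT AT LEVEL `N`, CARRIER-LEVEL Δ-LAWS** ([EtTh] Prop. 5.5 ⊕ Thm. 5.6 (i) at abc-iut-L2-t4's `ofConnectedTemperoidData` with
`Q := levelStub`, `P` pinned at `B_N^bs` by BOTH pins): `…_levelN` with the naturality `haΨn` of the Δ-transport and the T56-L09c
compatibility `hΔ` (abc-iut-w5-d020's `Thm56Sub.DeltaTransportCompat`) DERIVED from carrier-level laws `(hδn, hδc)` of a lift `δ` of `aΨ` to
abc-iut-L2-t9's `(l·Δ_Θ)_(−)` — the currency of abc-iut-w5-d013's producers.  [cite: MochizukiEtTh2009, Thm 5.6 p.328–329 (PDF pp.102–103)] -/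
theorem exists_rigidityFamily_unique_preserved_ofConnectedTemperoidData_levelN_carrier
    -- Prop 5.5 side (η / ν pin, reachability, stub laws)
    (hB : (ofConnectedTemperoidData h (RD.levelStub ιX) odd_l R ιX K' constEmb constEmb_injective hinvc hinvp).IsThetaSaturated (ofConnectedTemperoidData h (RD.levelStub ιX) odd_l R ιX K' constEmb constEmb_injective hinvc hinvp).BN) (P : ThetaSubquotientProj (ofConnectedTemperoidData h (RD.levelStub ιX) odd_l R ιX K' constEmb constEmb_injective hinvc hinvp))
    -- the ONE pin: `P` at `B_N^bs` is print's `Aut`-subquotient domain `autPre q_N ι_N` read through `Aut_D(B_N^bs) ↪ Aut(B_N^bs.obj)`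
    -- (abc-iut-w4-d042's `hPpre`; DUAL CLAUSE G-w4d042g3-1: no `P`-TERM until v-next `proj_surjective_of_isGaloisObj`)
    (hPpre : P.pre R.BN.base =
      (ThetaSubquotient.autPre (RD.qN ιX) RD.iotaN R.BN.base.obj).comap (Functor.mapAut R.BN.base (connectedObjects (BTemp X.Pi)).ι))
    [RD.iotaN.range.Normal]
    -- the SECOND pin: `P.proj` at `B_N^bs` IS print's projection `autProj q_N ι_N` (abc-iut-w4-d042's proj-pin convention; its
    -- producers `e`/`he`/`hPproj`/`hproj` under this pin are abc-iut-w4-d042's row — here only CONSUMED as hypotheses)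
    (hPproj_pin : ∀ (g : Aut ((ofConnectedTemperoidData h (RD.levelStub ιX) odd_l R ιX K' constEmb constEmb_injective hinvc hinvp).base.obj (ofConnectedTemperoidData h (RD.levelStub ιX) odd_l R ιX K' constEmb constEmb_injective hinvc hinvp).BN)) (hg : g ∈ P.pre ((ofConnectedTemperoidData h (RD.levelStub ιX) odd_l R ιX K' constEmb constEmb_injective hinvc hinvp).base.obj (ofConnectedTemperoidData h (RD.levelStub ιX) odd_l R ιX K' constEmb constEmb_injective hinvc hinvp).BN))
      (hg' : Functor.mapAut R.BN.base (connectedObjects (BTemp X.Pi)).ι g ∈ ThetaSubquotient.autPre (RD.qN ιX) RD.iotaN R.BN.base.obj),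
      P.proj ((ofConnectedTemperoidData h (RD.levelStub ιX) odd_l R ιX K' constEmb constEmb_injective hinvc hinvp).base.obj (ofConnectedTemperoidData h (RD.levelStub ιX) odd_l R ιX K' constEmb constEmb_injective hinvc hinvp).BN) ⟨g, hg⟩ = ThetaSubquotient.autProj (RD.qN ιX) RD.iotaN R.BN.base.obj ⟨_, hg'⟩)
    {η₀ : RD.PiYdd → RD.mu} (hη₀ : η₀ ∈ RD.thetaCocycles)
    (hdies : ∀ k : RD.PiYdd, rhoOfBiKummerData R ιX k = 1 → η₀ k = 1)
    (e : RD.mu → (ofConnectedTemperoidData h (RD.levelStub ιX) odd_l R ιX K' constEmb constEmb_injective hinvc hinvp).lDeltaModN (ofConnectedTemperoidData h (RD.levelStub ιX) odd_l R ιX K' constEmb constEmb_injective hinvc hinvp).BN) (he : Function.Surjective e)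
    (hPproj : ∀ (k : RD.PiYdd) (hk : (k : RD.PiX) ∈ RD.lDeltaTheta) (hm : rhoOfBiKummerData R ιX k ∈ P.pre _),
      (QuotientGroup.mk (P.proj _ ⟨rhoOfBiKummerData R ιX k, hm⟩) : (ofConnectedTemperoidData h (RD.levelStub ιX) odd_l R ιX K' constEmb constEmb_injective hinvc hinvp).lDeltaModN (ofConnectedTemperoidData h (RD.levelStub ιX) odd_l R ιX K' constEmb constEmb_injective hinvc hinvp).BN) = e (RD.thetaMod ⟨k, hk⟩))
    (ν : (ofConnectedTemperoidData h (RD.levelStub ιX) odd_l R ιX K' constEmb constEmb_injective hinvc hinvp).lDeltaModN (ofConnectedTemperoidData h (RD.levelStub ιX) odd_l R ιX K' constEmb constEmb_injective hinvc hinvp).BN ≃* (ofConnectedTemperoidData h (RD.levelStub ιX) odd_l R ιX K' constEmb constEmb_injective hinvc hinvp).muTorsion (ofConnectedTemperoidData h (RD.levelStub ιX) odd_l R ιX K' constEmb constEmb_injective hinvc hinvp).BN (ofConnectedTemperoidData h (RD.levelStub ιX) odd_l R ιX K' constEmb constEmb_injective hinvc hinvp).N)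
    (hKν : ∀ η : (ofConnectedTemperoidData h (RD.levelStub ιX) odd_l R ιX K' constEmb constEmb_injective hinvc hinvp).HB → (ofConnectedTemperoidData h (RD.levelStub ιX) odd_l R ιX K' constEmb constEmb_injective hinvc hinvp).lDeltaModN (ofConnectedTemperoidData h (RD.levelStub ιX) odd_l R ιX K' constEmb constEmb_injective hinvc hinvp).BN,
      (∀ k : RD.PiYdd, η ⟨rhoOfBiKummerData R ιX k, Subgroup.mem_map_of_mem _ k.2⟩ = e (η₀ k)) →
        FrobenioidThetaBiKummer.ThetaPairKummerClass (ofConnectedTemperoidData h (RD.levelStub ιX) odd_l R ιX K' constEmb constEmb_injective hinvc hinvp) η ν)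
    -- T56-L09b: Prop 3.4 (ii) constants + the origin clause «cnst kills Ker aug» (G-w5d020-2)
    {Dcnst : Type u₁} [Category.{v₁} Dcnst] {cnst : D₀ ⥤ Dcnst} (hP34 : RealifiedDivisorMonoids.Prop34Cnst T₀ cnst)
    (hΔcnst : ∀ δ ∈ RD.aug.ker,
      cnst.map (tf.base.map (rhoOfBiKummerData R ιX δ).hom) = 𝟙 (cnst.obj (tf.base.obj R.BN.base)))
    (hreach : LinearlyReachableFromBN (ofConnectedTemperoidData h (RD.levelStub ιX) odd_l R ιX K' constEmb constEmb_injective hinvc hinvp))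
    -- P55-L06 leaves: hproj named (leaf (G) `hGalT` is a THEOREM here: Galois objects of B^temp(Π)⁰ are Aut-torsors)
    (hproj : ∀ (g g' : Aut ((ofConnectedTemperoidData h (RD.levelStub ιX) odd_l R ιX K' constEmb constEmb_injective hinvc hinvp).base.obj (ofConnectedTemperoidData h (RD.levelStub ιX) odd_l R ιX K' constEmb constEmb_injective hinvc hinvp).BN)) (hh : g' ∈ P.pre _), ∃ hgh : g * g' * g⁻¹ ∈ P.pre _,
      (ofConnectedTemperoidData h (RD.levelStub ιX) odd_l R ιX K' constEmb constEmb_injective hinvc hinvp).lDeltaMap g.hom (P.proj _ ⟨g', hh⟩) = P.proj _ ⟨g * g' * g⁻¹, hgh⟩)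
    -- hKR (G-L6t23-3) by abc-iut-w4-d099's PIN route (p-file Sec5ThetaSectionCompatOfKummerClass): «Prop 5.2 (iii) enters ONCE» —
    -- the (η₀, ν) pin above + Facts + the cyclotome dictionary m with m ∘ ν ∘ e = id + cyclotomic-character compatibility (F-1306)
    (H : (ofConnectedTemperoidData h (RD.levelStub ιX) odd_l R ιX K' constEmb constEmb_injective hinvc hinvp).Facts)
    (m : (ofConnectedTemperoidData h (RD.levelStub ιX) odd_l R ιX K' constEmb constEmb_injective hinvc hinvp).muTorsion (ofConnectedTemperoidData h (RD.levelStub ιX) odd_l R ιX K' constEmb constEmb_injective hinvc hinvp).BN (ofConnectedTemperoidData h (RD.levelStub ιX) odd_l R ιX K' constEmb constEmb_injective hinvc hinvp).N ≃* RD.mu)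
    (hme : ∀ x : RD.mu, m (ν (e x)) = x)
    (hχX : (ofConnectedTemperoidData h (RD.levelStub ιX) odd_l R ιX K' constEmb constEmb_injective hinvc hinvp).CyclotomicCharacterCompatX RD.toThetaEnvData (MulEquiv.refl _) m)
    -- hdiff reduced to Π^tp_Ÿ ⊆ H_⊙ (`hfrac`, `haut` are THEOREMS here: [FrdI] Thm 5.2 (ii) dictionary, abc-iut-L2-t9/t4)
    (hH : ∀ y : RD.PiX, y ∈ RD.PiYdd → ιX y ∈ (BiKummerSetting.mkOfConnectedTemperoid X tf hZ hP NH A₀ hA₀ hA₀').Hodot)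
    -- Thm 5.6 side: Ψ, its base shadow, Δ-transport and μ-pull data (abc-iut-L2-d4)
    (Ψ : (BiKummerSetting.mkOfConnectedTemperoid X tf hZ hP NH A₀ hA₀ hA₀').C ≌ (BiKummerSetting.mkOfConnectedTemperoid X tf hZ hP NH A₀ hA₀ hA₀').C) (Ψbs : ConnectedPart (BTemp X.Pi) ⥤ ConnectedPart (BTemp X.Pi)) [Ψbs.IsEquivalence] (eΨ : Ψ.functor ⋙ (ofConnectedTemperoidData h (RD.levelStub ιX) odd_l R ιX K' constEmb constEmb_injective hinvc hinvp).base ≅ (ofConnectedTemperoidData h (RD.levelStub ιX) odd_l R ιX K' constEmb constEmb_injective hinvc hinvp).base ⋙ Ψbs)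
    (aΨ : ∀ A : (BiKummerSetting.mkOfConnectedTemperoid X tf hZ hP NH A₀ hA₀ hA₀').C, (ofConnectedTemperoidData h (RD.levelStub ιX) odd_l R ιX K' constEmb constEmb_injective hinvc hinvp).lDeltaModN A ≃* (ofConnectedTemperoidData h (RD.levelStub ιX) odd_l R ιX K' constEmb constEmb_injective hinvc hinvp).lDeltaModN (Ψ.functor.obj A))
    -- the Δ-transport `aΨ` (𝔉-level, `⊗ ℤ/Nℤ`) together with its CARRIER-LEVEL lift `δ` on abc-iut-L2-t9's `(l·Δ_Θ)_E = LDelta q_N ι_N E`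
    -- (BEFORE `⊗ ℤ/Nℤ`; the shape of abc-iut-w5-d013's `ThetaSubquotient.psiTransport q_N ι_N φ φQ φΛ hq hι Ψbs η A.base (Ψ A).base (eΨ.app A)`,
    -- p442611) and the identification `haΨδ` (for `aΨ A := modPowEquiv (δ A) N` it is `modPowEquiv_mk`, `rfl`)
    (δ : ∀ A : (BiKummerSetting.mkOfConnectedTemperoid X tf hZ hP NH A₀ hA₀ hA₀').C,
      ThetaSubquotient.LDelta (RD.qN ιX) RD.iotaN A.base.obj ≃* ThetaSubquotient.LDelta (RD.qN ιX) RD.iotaN (Ψ.functor.obj A).base.obj)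
    (haΨδ : ∀ (A : (BiKummerSetting.mkOfConnectedTemperoid X tf hZ hP NH A₀ hA₀ hA₀').C) (y : ThetaSubquotient.LDelta (RD.qN ιX) RD.iotaN A.base.obj),
      aΨ A (QuotientGroup.mk y) = QuotientGroup.mk (δ A y))
    (hlin : PreFrobenioidData.PreservesMor Ψ.functor (ofConnectedTemperoidData h (RD.levelStub ιX) odd_l R ιX K' constEmb constEmb_injective hinvc hinvp).IsLinear (ofConnectedTemperoidData h (RD.levelStub ιX) odd_l R ιX K' constEmb constEmb_injective hinvc hinvp).IsLinear)
    -- naturality at the CARRIER level (shape of abc-iut-w5-d013's `map_psiTransport` for the `eΨ`-squares)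
    (hδn : ∀ {A A' : (BiKummerSetting.mkOfConnectedTemperoid X tf hZ hP NH A₀ hA₀ hA₀').C} (φ : A ⟶ A') (y : ThetaSubquotient.LDelta (RD.qN ιX) RD.iotaN A.base.obj),
      ThetaSubquotient.map (RD.qN ιX) RD.iotaN (Ψ.functor.obj A).base.property (Ψ.functor.obj A').base.property
          ((ofConnectedTemperoidData h (RD.levelStub ιX) odd_l R ιX K' constEmb constEmb_injective hinvc hinvp).base.map (Ψ.functor.map φ)).hom (δ A y) =
        δ A' (ThetaSubquotient.map (RD.qN ιX) RD.iotaN A.base.property A'.base.property ((ofConnectedTemperoidData h (RD.levelStub ιX) odd_l R ιX K' constEmb constEmb_injective hinvc hinvp).base.map φ).hom y))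
    (hpull : ∀ {A A' : (BiKummerSetting.mkOfConnectedTemperoid X tf hZ hP NH A₀ hA₀ hA₀').C} (φ : A ⟶ A') (u : (ofConnectedTemperoidData h (RD.levelStub ιX) odd_l R ιX K' constEmb constEmb_injective hinvc hinvp).muTorsion A' (ofConnectedTemperoidData h (RD.levelStub ιX) odd_l R ιX K' constEmb constEmb_injective hinvc hinvp).N)
      (hu : Ψ.functor.mapAut A' (u : Aut A') ∈ (ofConnectedTemperoidData h (RD.levelStub ιX) odd_l R ιX K' constEmb constEmb_injective hinvc hinvp).muTorsion (Ψ.functor.obj A') (ofConnectedTemperoidData h (RD.levelStub ιX) odd_l R ιX K' constEmb constEmb_injective hinvc hinvp).N),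
      Ψ.functor.mapAut A ((ofConnectedTemperoidData h (RD.levelStub ιX) odd_l R ιX K' constEmb constEmb_injective hinvc hinvp).muTorsionPull φ (ofConnectedTemperoidData h (RD.levelStub ιX) odd_l R ιX K' constEmb constEmb_injective hinvc hinvp).N u : Aut A) = ((ofConnectedTemperoidData h (RD.levelStub ιX) odd_l R ιX K' constEmb constEmb_injective hinvc hinvp).muTorsionPull (Ψ.functor.map φ) (ofConnectedTemperoidData h (RD.levelStub ιX) odd_l R ιX K' constEmb constEmb_injective hinvc hinvp).N ⟨_, hu⟩ : Aut (Ψ.functor.obj A)))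
    -- the NORMALISED Thm 5.7 transport (D_c = 1, e = 1: abc-iut-L2-d4 T1 + abc-iut-w5-d245 `capCupTransport_normalise`)
    (α : Ψ.functor.obj (ofConnectedTemperoidData h (RD.levelStub ιX) odd_l R ιX K' constEmb constEmb_injective hinvc hinvp).AN ≅ (ofConnectedTemperoidData h (RD.levelStub ιX) odd_l R ιX K' constEmb constEmb_injective hinvc hinvp).AN) (β : Ψ.functor.obj (ofConnectedTemperoidData h (RD.levelStub ιX) odd_l R ιX K' constEmb constEmb_injective hinvc hinvp).BN ≅ (ofConnectedTemperoidData h (RD.levelStub ιX) odd_l R ιX K' constEmb constEmb_injective hinvc hinvp).BN) {Dp₀ : Aut (ofConnectedTemperoidData h (RD.levelStub ιX) odd_l R ιX K' constEmb constEmb_injective hinvc hinvp).BN}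
    (hc₁ : α.inv ≫ Ψ.functor.map (ofConnectedTemperoidData h (RD.levelStub ιX) odd_l R ιX K' constEmb constEmb_injective hinvc hinvp).sCap ≫ β.hom = (ofConnectedTemperoidData h (RD.levelStub ιX) odd_l R ιX K' constEmb constEmb_injective hinvc hinvp).sCap)
    (hp₁ : α.inv ≫ Ψ.functor.map (ofConnectedTemperoidData h (RD.levelStub ιX) odd_l R ιX K' constEmb constEmb_injective hinvc hinvp).sCup ≫ β.hom = (ofConnectedTemperoidData h (RD.levelStub ιX) odd_l R ιX K' constEmb constEmb_injective hinvc hinvp).sCup ≫ Dp₀.hom) (hDp₀ : Dp₀ ∈ (ofConnectedTemperoidData h (RD.levelStub ιX) odd_l R ιX K' constEmb constEmb_injective hinvc hinvp).units (ofConnectedTemperoidData h (RD.levelStub ιX) odd_l R ιX K' constEmb constEmb_injective hinvc hinvp).BN)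
    -- [FrdI] Prop 5.6 / Thm 3.4 (iii) data at A_N (abc-iut-w5-d245's Prop 5.6 unit)
    -- the MODEL HYPOTHESES of [FrdI] Thm 3.4 (iii)/(v) at the §4 tempered Frobenioid ([EtTh] Thm 3.7 (i)(ii))
    (hD : IsOfFSMType (ConnectedPart (BTemp X.Pi))) (hslim : IsSlim (ConnectedPart (BTemp X.Pi))) (hnd : IsNonDilatingOn tf.divisorMonoid)
    (hN : ∃ A : (BiKummerSetting.mkOfConnectedTemperoid X tf hZ hP NH A₀ hA₀ hA₀').C, ¬ (PreFrobenioidData.ofModel tf.divisorMonoid tf.ratFnFunctor tf.divBNatTrans).IsGroupLikeObj A)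
    -- [EtTh] Cor 2.18 (i): the theta-related subquotients Π^tp_Ÿ, (l·Δ_Θ), … of Π^tp_X are CHARACTERISTIC (abc-iut-L2-t2's
    -- `RigidData.Cor218_i`, F-0620; discharged at the model data by abc-iut-L2-t8/L6) — supplies hP24/hγL for EVERY γ
    (h218i : RD.Cor218_i)
    -- T56-L09c at the CARRIER level (shape of abc-iut-w5-d013's `psiTransport_autProj` + `map_autProj_iso` + the identification of the
    -- conjugating isomorphism): at `B_N^bs`, `map (β^bs) ∘ δ_{B_N} ∘ autProj = autProj ∘ θ′` on print's `Aut`-subquotient domain, where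
    -- `θ′ := (s'_N)^bs-conjugate` of the base shadow `θA` of `Ψ` through `α` (no γ, no `P`, no `e`)
    (hδc : ∀ θA : Aut R.AN.base ≃* Aut R.AN.base,
      (∀ f : Aut R.AN, (PreFrobenioid.baseFunctor (BiKummerSetting.mkOfConnectedTemperoid X tf hZ hP NH A₀ hA₀ hA₀').F).mapIso (α.symm ≪≫ Ψ.functor.mapIso f ≪≫ α) =
        θA ((PreFrobenioid.baseFunctor (BiKummerSetting.mkOfConnectedTemperoid X tf hZ hP NH A₀ hA₀ hA₀').F).mapIso f)) →
      ∀ (g : Aut R.BN.base)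
        (hg : Functor.mapAut R.BN.base (connectedObjects (BTemp X.Pi)).ι g ∈ ThetaSubquotient.autPre (RD.qN ιX) RD.iotaN R.BN.base.obj),
        ∃ hθg : Functor.mapAut R.BN.base (connectedObjects (BTemp X.Pi)).ι ((BiKummerSetting.NthRoot.baseIso (BiKummerSetting.mkOfConnectedTemperoid X tf hZ hP NH A₀ hA₀ hA₀') R).conjAut (θA ((BiKummerSetting.NthRoot.baseIso (BiKummerSetting.mkOfConnectedTemperoid X tf hZ hP NH A₀ hA₀ hA₀') R).conjAut.symm g))) ∈
            ThetaSubquotient.autPre (RD.qN ιX) RD.iotaN R.BN.base.obj,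
          ThetaSubquotient.map (RD.qN ιX) RD.iotaN (Ψ.functor.obj R.BN).base.property R.BN.base.property ((ofConnectedTemperoidData h (RD.levelStub ιX) odd_l R ιX K' constEmb constEmb_injective hinvc hinvp).base.map β.hom).hom
              (δ R.BN (ThetaSubquotient.autProj (RD.qN ιX) RD.iotaN R.BN.base.obj ⟨_, hg⟩)) =
            ThetaSubquotient.autProj (RD.qN ιX) RD.iotaN R.BN.base.obj ⟨_, hθg⟩) :
    ∃ ρ : RigidityFamily (ofConnectedTemperoidData h (RD.levelStub ιX) odd_l R ιX K' constEmb constEmb_injective hinvc hinvp), IsKummerDetermined (ofConnectedTemperoidData h (RD.levelStub ιX) odd_l R ιX K' constEmb constEmb_injective hinvc hinvp) P ρ hB ∧ IsFunctorialLinear (ofConnectedTemperoidData h (RD.levelStub ιX) odd_l R ιX K' constEmb constEmb_injective hinvc hinvp) ρ ∧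
      (∀ ρ' : RigidityFamily (ofConnectedTemperoidData h (RD.levelStub ιX) odd_l R ιX K' constEmb constEmb_injective hinvc hinvp), IsKummerDetermined (ofConnectedTemperoidData h (RD.levelStub ιX) odd_l R ιX K' constEmb constEmb_injective hinvc hinvp) P ρ' hB → IsFunctorialLinear (ofConnectedTemperoidData h (RD.levelStub ιX) odd_l R ιX K' constEmb constEmb_injective hinvc hinvp) ρ' → ρ' = ρ) ∧
      CyclotomicRigidityPreserved (ofConnectedTemperoidData h (RD.levelStub ιX) odd_l R ιX K' constEmb constEmb_injective hinvc hinvp) Ψ ρ aΨ := by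
  -- `⊗ ℤ/Nℤ` on classes for the data (`QuotientGroup.map_mk`) and the data's transport IS abc-iut-L2-t9's `map` (`rfl`)
  have hmk : ∀ {A A' : (BiKummerSetting.mkOfConnectedTemperoid X tf hZ hP NH A₀ hA₀ hA₀').C} (f : A ⟶ A') (z : ThetaSubquotient.LDelta (RD.qN ιX) RD.iotaN A.base.obj),
      (ofConnectedTemperoidData h (RD.levelStub ιX) odd_l R ιX K' constEmb constEmb_injective hinvc hinvp).lDeltaModNMap f (QuotientGroup.mk z) =
        QuotientGroup.mk (ThetaSubquotient.map (RD.qN ιX) RD.iotaN A.base.property A'.base.property ((ofConnectedTemperoidData h (RD.levelStub ιX) odd_l R ιX K' constEmb constEmb_injective hinvc hinvp).base.map f).hom z) :=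
    fun _ _ => rfl
  -- haΨn from hδn
  have haΨn : ∀ {A A' : (BiKummerSetting.mkOfConnectedTemperoid X tf hZ hP NH A₀ hA₀ hA₀').C} (φ : A ⟶ A') (x : (ofConnectedTemperoidData h (RD.levelStub ιX) odd_l R ιX K' constEmb constEmb_injective hinvc hinvp).lDeltaModN A),
      aΨ A' ((ofConnectedTemperoidData h (RD.levelStub ιX) odd_l R ιX K' constEmb constEmb_injective hinvc hinvp).lDeltaModNMap φ x) = (ofConnectedTemperoidData h (RD.levelStub ιX) odd_l R ιX K' constEmb constEmb_injective hinvc hinvp).lDeltaModNMap (Ψ.functor.map φ) (aΨ A x) := by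
    intro A A' φ x
    induction x using QuotientGroup.induction_on with
    | H y =>
      exact (congrArg (aΨ A') (hmk φ y)).trans <| (haΨδ A' _).trans <|
        (congrArg QuotientGroup.mk (hδn φ y)).symm.trans <| (hmk (Ψ.functor.map φ) (δ A y)).symm.trans <|
          congrArg ((ofConnectedTemperoidData h (RD.levelStub ιX) odd_l R ιX K' constEmb constEmb_injective hinvc hinvp).lDeltaModNMap (Ψ.functor.map φ)) (haΨδ A y).symm
  -- hΔ: abc-iut-w5-d020's `DeltaTransportCompat` from the carrier-level law `hδc` through the two pins (everything evaluated at `B_N^bs`)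
  have hΔ : ∀ θA : Aut R.AN.base ≃* Aut R.AN.base,
      (∀ f : Aut R.AN, (PreFrobenioid.baseFunctor (BiKummerSetting.mkOfConnectedTemperoid X tf hZ hP NH A₀ hA₀ hA₀').F).mapIso (α.symm ≪≫ Ψ.functor.mapIso f ≪≫ α) =
        θA ((PreFrobenioid.baseFunctor (BiKummerSetting.mkOfConnectedTemperoid X tf hZ hP NH A₀ hA₀ hA₀').F).mapIso f)) →
      Thm56Sub.DeltaTransportCompat (ofConnectedTemperoidData h (RD.levelStub ιX) odd_l R ιX K' constEmb constEmb_injective hinvc hinvp) Ψ β aΨ (((ofConnectedTemperoidData h (RD.levelStub ιX) odd_l R ιX K' constEmb constEmb_injective hinvc hinvp).autBaseIsoAB.symm.trans θA).trans (ofConnectedTemperoidData h (RD.levelStub ιX) odd_l R ιX K' constEmb constEmb_injective hinvc hinvp).autBaseIsoAB) P := by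
    intro θA hθ g hg
    have hg₁ : g ∈ P.pre R.BN.base := hg
    rw [hPpre] at hg₁
    obtain ⟨hθg', hc⟩ := hδc θA hθ g hg₁
    have hθg : (((ofConnectedTemperoidData h (RD.levelStub ιX) odd_l R ιX K' constEmb constEmb_injective hinvc hinvp).autBaseIsoAB.symm.trans θA).trans (ofConnectedTemperoidData h (RD.levelStub ιX) odd_l R ιX K' constEmb constEmb_injective hinvc hinvp).autBaseIsoAB) g ∈ P.pre R.BN.base := by
      rw [hPpre]
      exact hθg'
    refine ⟨hθg, ?_⟩
    exact (congrArg (fun z => (ofConnectedTemperoidData h (RD.levelStub ιX) odd_l R ιX K' constEmb constEmb_injective hinvc hinvp).lDeltaModNMap β.hom (aΨ _ (QuotientGroup.mk z))) (hPproj_pin g hg hg₁)).trans <|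
      (congrArg ((ofConnectedTemperoidData h (RD.levelStub ιX) odd_l R ιX K' constEmb constEmb_injective hinvc hinvp).lDeltaModNMap β.hom) (haΨδ _ _)).trans <| (hmk β.hom _).trans <|
        (congrArg QuotientGroup.mk hc).trans <| congrArg QuotientGroup.mk (hPproj_pin _ hθg hθg').symm
  -- EXPLICIT universes: unifying `max ?u₀ ?w'` against `max u₀ w'` otherwise sends `isDefEq` into δ-unfolding the §5 stack (the
  -- «heartbeat wall» of this lineage is this level-unification fallback, not the mathematics)
  exact exists_rigidityFamily_unique_preserved_ofConnectedTemperoidData_levelN.{u₀, v₀, w', v₁, u₁} h odd_l R ιX K' constEmb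
    constEmb_injective
    hinvc hinvp hB P hPpre hη₀ hdies e he hPproj ν hKν hP34 hΔcnst hreach hproj H m hme hχX hH Ψ Ψbs eΨ aΨ hlin haΨn hpull α β
    hc₁ hp₁ hDp₀ hD hslim hnd hN h218i hΔ

end Connected

end ThetaFrobenioid

end Literature.AnabelianGeometry.EtaleTheta

end
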